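import Summits.QuantumFields.YangMills.Theorems.BalabanUVNodesN16PinnedLooseMatch
import Summits.QuantumFields.YangMills.Theorems.BalabanUVNodesN16H7LooseOfReg910SlotFamily

/-!
# Route «BalabanUVNodes», crux K3⁷ `SpineGivenEndpointR13SepCoPH` (stmt-QuantumFields-20544), skeleton v5 941dddb108cbaacf — node N16 = NE3: THE PRODUCER OF v5's THREE N16 CONJUNCTS
# RE-KEYED TO THE SLOT KEY (T9ˢ) — module 45's `…_loose_of_h5_thm1At_match` with the REFUTED all-cube Theorem-1 reading `(hM, hT : ∀ k, Thm1At C (torusVP …))` replaced by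
# dag-n16-w1's slot-cube regularity binder `hR` ([Balaban1985Variational] Thm 1 (9)–(10) on print's cube class only)

Cell `pub-ymgap`, seat `pub-ymgap-dag-n16-e` (R134 acceleration seat (a), strategy s2 = BY-NAME KNIT at the record; HUMAN RULING D-0062; chair R424 venue), generation 16,
module 47 (THEOREMS ONLY, 0 `def`, 0 `sorry`, standard axioms).  `--kind proof --supports stmt-QuantumFields-20544 --as helper` (count-neutral; proves NO registered stub).
`bears_on: R4∕N16 · edges N05 → N16, N07 → N16 · out-edge N16 → N19 ∕ N21`.  Over module 45 `…N16PinnedLooseMatch` (p604267: `radiusMatch_max`, `radiusMatch_max₄`, `looseDom_anti`,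
`n16HolderAt_anti_dom`, `exists_gradConst_eq`, the N19-side faces) and dag-n16-w1's `…N16H7LooseOfReg910SlotFamily` (`exists_letters_inEndRegimeH_leafSlotHolderAT_of_h5_reg910Slot`:
the per-family letters at the loose object of radius `ε ∕ B₃` from `h5` and the SLOT KEY) — CITED BY NAME, none edited.

WHY THIS FILE EXISTS.  dag-n16-w2 g4 `…N16Thm1AtTorusVPSmallCubes.not_forall_thm1At_torusVP` ∕ `not_stub_thm1At` (rank two) and dag-n16-w5 `…SmallCubesRankN.not_forall_thm1At_torusVP_rankN`
(every rank) REFUTE the displayed binder «`∀ k, Thm1At C (torusVP d L N G (k+1))`» together with the first-order (9)_{β₀=1} interface: leaf-06's `torusVP` reads (9)–(10) on ALL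
lattice cubes with a size-PROPORTIONAL factor (D-s3-3), and the five-site cube then forces deep-level minimisers flat.  Hence module 45 §2 (and 43 §4's Thm-1 producer, 46) are VACUOUS
AS TYPED (chair A6; this seat's ACK pub-ymgap INBOX l.30228).  dag-n16-w1 g5's repair keys Theorem 1's regularity on the SLOT cubes only — the binder `hR` below (= their (T9ˢ); every
existing big-cube proof meets it, `cubeM ∈ [2, 7∕2]`, and the refuting five-site cube misses it).  This file is module 45 §2 VERBATIM with `(hM, hT) ↦ hR`: same MATCH radius
`B F := max (C F).B₃ ((ℓ₃ F).ε ∕ (ℓ₃ F).b)`, same antitonicity descent, same conclusion — v5's three N16 conjuncts `N16PinnedLoose 𝔯 ℓ₃ B ∧ N16LettersEnd N g ℓ₃ ∧ ⟨N16RadiusMatch ℓ₃ B⟩`.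

HONEST FRAMING.  Kernel bookkeeping by name; no estimate; `h5` (node N05's Thm-4 ∕ Prop-3 bodies at exponent β on the pinned all-torus sub-family) and the slot key `hR`
([Balaban1985Variational] Thm 1 (9)–(10) at leaf-06's torus objects ON THE SLOT CUBES — node N07's content) are DISPLAYED hypotheses asserted for no family (not refuted: the slot
cubes have `M ≥ 2`); nothing of Bałaban asserted; no stub of K3⁷ closed; N16 ∕ N07 ∕ N19 NOT discharged; the skeleton is the planner's and is NOT edited; counts UNMOVED (typed 28∕28 ·
discharged 5∕27, A 5∕28); one finite four-torus at fixed ε — NOT ℝ⁴ ∕ infinite volume ∕ OS ∕ mass gap ∕ Clay.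
-/

set_option autoImplicit false

open scoped BigOperators Matrix Matrix.Norms.L2Operator
open NormedSpace

namespace Summit.QuantumFields.YangMills.BalabanUVNodes.N16PinnedLooseMatchOfReg910Slot

open Literature.MathematicalPhysics.QuantumFieldTheory.Balaban1983to89
open Literature.MathematicalPhysics.QuantumFieldTheory.Balaban1983to89.T4Continuum (T4Family ULoop)
open B7Prop1Explicit B7Prop2Explicit MatrixLog UnitaryModel
open T4AveragingDeficitWall hiding Site Plaq Bond
open B7Prop3Flat (c3)
open B8LeafModelZd (ZdIdx)
open B8LeafModelZd3 (zdGF3)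
open Node00 (Stage13HParams NE3Objects₁₁ NE3Letters₁₁ ne3ConstLayerOfRecord₁₁ ne3NperOfRecord₁₁ ne3DomOfRecord₁₁ MatA)
open Summit.QuantumFields.BalabanUV.T4Continuum
open MinimalActionSandwich (IsMinimiser)
open MinimalActionRate (sfClass)
open MinimalActionRefine (gradConst)
open MinimalActionDictionary (torusVP RadiiMono)
open AveragingDeficitLatticeH2Prep (fd)
open B11 (Regularity)
open YMDAG.UVSplit (NE3Carriers ne3OfRecord₁₁ RateReading₁₃CoPH rateCarriersOfRecord₁₃CoPH)
open Summit.QuantumFields.YangMills.BalabanUVNodes.N16HolderDefs (N16HolderAt)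
open Summit.QuantumFields.YangMills.BalabanUVNodes.N16HolderRegime (InEndRegimeH radiusOfRecordH constOfRecordH)
open Summit.QuantumFields.YangMills.BalabanUVNodes.N16LeafSlotAllTorus (n16HolderAt_of_inEndRegimeH_leafSlotHolderAT)
open Summit.QuantumFields.YangMills.BalabanUVNodes.N16H7LooseOfReg910SlotFamily (exists_letters_inEndRegimeH_leafSlotHolderAT_of_h5_reg910Slot)
open Summit.QuantumFields.YangMills.BalabanUVNodes.N16PinnedLayer13CoPH (N16PinnedLoose N16LettersEnd N16HolderAtReading inEndRegimeH_loose_iff n16HolderAtReading_of_pinnedLoose)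
open Summit.QuantumFields.YangMills.BalabanUVNodes.N16PinnedLooseMatch (n16HolderAt_anti_dom looseDom_anti radiusMatch_max radiusMatch_max₄ exists_gradConst_eq)

noncomputable section

variable {N : ℕ} [NeZero N] {β : ℝ} (hβ0 : 0 ≤ β) (hβ1 : β ≤ 1)
include hβ0 hβ1

/-- **★ THE PRODUCER OF K3⁷ v5's THREE N16 CONJUNCTS AT THE SLOT KEY** — `N16PinnedLoose 𝔯 ℓ₃ B`, `N16LettersEnd N g ℓ₃`, and the MATCH row `∀ F, 0 < B F ∧ (ℓ₃ F).ε ∕ B F ≤ (ℓ₃ F).b`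
— FROM node N05's `h5` (37ᴴ's, VERBATIM), `g F > 0`, a local-gauge shape `G F` monotone in its radii with the (9)_{β₀=1} interface, constants `C F`, and the SLOT KEY `hR`: Theorem 1's
regularity (9)–(10) for every minimiser over `sfClass (B₃ε₁)` with an `ε₁`-loose datum, ON THE SLOT CUBE `K = L^{k+1} − 1 + L^{k+1} + 2` about every site (dag-n16-w1 (T9ˢ)).
`B F := max (C F).B₃ ((ℓ₃ F).ε ∕ (ℓ₃ F).b)` (so also `(C F).B₃ ≤ B F`).  Proof = module 45 §2's with the per-family step re-keyed. [cite: Balaban1985Variational, Thm 1 (9)–(10) p.279] [folklore] -/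
theorem exists_letters_n16HolderAtReading_loose_of_h5_reg910Slot_match {g : T4Family → ℝ} (hg : ∀ F, 0 < g F)
    (h5 : ∀ F : T4Family, letI : CStarAlgebra (Matrix (Fin N) (Fin N) ℂ) := {}
      ∃ (len : Site 4 → ℝ) (c₁ c₁' B₁' cP C₂ B₀β : ℝ) (inp : B8.B9Inputs),
        (∀ v : Site 4, 0 < len v → 1 ≤ len v) ∧ (∀ μ : Fin 4, len (e μ) = 1) ∧ 0 < B₁' ∧ 5 * ((4 : ℕ) : ℝ) * F.L * inp.B₀ ≤ B₁' ∧ 0 < c₁' ∧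
        (∀ α₀ α₁ : ℝ, 0 < α₀ → 0 < α₁ → α₀ + α₁ ≤ c₁' →
          α₀ + α₁ ≤ c₁ ∧ C0 4 * (2 * α₀) ≤ 1 / 3 ∧ 4 * α₀ ≤ c2' 4 F.L ∧ 16 * (B₁' * (α₀ + α₁)) ≤ 1 ∧
          Real.exp (4 * (800 * (((4 : ℕ) : ℝ) + 1) ^ 2 * (((4 : ℕ) : ℝ) + 4)) * α₀) * (1 + 8 * (131072 * (((4 : ℕ) : ℝ) + 1) ^ 2) * (B₁' * (α₀ + α₁))) ≤ 2 ∧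
          2 * (B₁' * (α₀ + α₁)) ≤ c3 4 F.L ∧ ((4 : ℕ) : ℝ) * F.L * α₁ ≤ 1 / 8 ∧ α₀ ≤ cP ∧ α₁ ≤ cP ∧ B₁' * (α₀ + α₁) ≤ cP ∧
          2 * (B₁' * (α₀ + α₁)) ^ 2 + 20 * ((4 : ℕ) : ℝ) * α₀ * (B₁' * (α₀ + α₁)) + 2 * C₂ * (B₁' * (α₀ + α₁)) ^ 2 ≤ α₀ + α₁) ∧
        B8.Thm4Body c₁ B₁' (fun i : {i : ZdIdx 4 F.L // (∀ j, i.Ω j = Set.univ) ∧ (∀ m j, i.Λs m j = {_y | j = m}) ∧ (∀ m j, i.Λb m j = {_c | j = m}) ∧ i.η = ((F.L : ℝ)⁻¹) ^ i.k} => (zdGF3 (Matrix (Fin N) (Fin N) ℂ) F.L β len i.1).toGFData) ∧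
        B8.Prop3Body cP 4 (F.L : ℝ) C₂ inp B₀β (fun i : {i : ZdIdx 4 F.L // (∀ j, i.Ω j = Set.univ) ∧ (∀ m j, i.Λs m j = {_y | j = m}) ∧ (∀ m j, i.Λb m j = {_c | j = m}) ∧ i.η = ((F.L : ℝ)⁻¹) ^ i.k} => (zdGF3 (Matrix (Fin N) (Fin N) ℂ) F.L β len i.1).toGFData2))
    {G : T4Family → (Site 4 → Fin 4 → (MatA N)ˣ) → Site 4 → ℕ → ℝ → ℝ → ℝ → Prop} (hGm : ∀ F, RadiiMono 4 (G F))
    (hG : ∀ (F : T4Family) (U : Site 4 → Fin 4 → (MatA N)ˣ) (x : Site 4) (K : ℕ) (α₀ α₁ α₂ : ℝ), 2 ≤ K → G F U x K α₀ α₁ α₂ →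
      ∃ (u : Site 4 → (MatA N)ˣ) (a : Site 4 → Fin 4 → MatA N),
        (∀ z, u z ∈ unitaryUnits (MatA N)) ∧
        (∀ (y : Site 4) (τ : Fin 4), l1 (y - x) ≤ 2 → ((gaugeAct u U y τ : (MatA N)ˣ) : MatA N) = exp (a y τ)) ∧
        (∀ (y : Site 4) (τ : Fin 4), l1 (y - x) ≤ 2 → ‖a y τ‖ ≤ α₀) ∧
        (∀ (y : Site 4) (τ i : Fin 4), l1 (y - x) ≤ 1 → ‖fd i (fun z => a z τ) y‖ ≤ α₁) ∧
        (∀ (τ i l : Fin 4), ‖fd i (fd l (fun z => a z τ)) x‖ ≤ α₂))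
    (C : T4Family → B11Thm1.Consts)
    (hR : ∀ (F : T4Family) (k : ℕ) (ε₁ : ℝ), 0 < ε₁ → ε₁ ≤ (C F).a₁ → ∀ (V U : Site 4 → Fin 4 → (MatA N)ˣ), V ∈ sfClass 4 F.L (ne3NperOfRecord₁₁ F 0 0) ε₁ 0 →
      IsMinimiser 4 (sfClass 4 F.L (ne3NperOfRecord₁₁ F 0 0) ((C F).B₃ * ε₁)) F.L (ne3NperOfRecord₁₁ F 0 0) (k + 1) V U →
        ∀ x : Site 4, Regularity (torusVP 4 F.L (ne3NperOfRecord₁₁ F 0 0) (G F) (k + 1)) (C F).B₃ (C F).B₄ ε₁ U (x, F.L ^ (k + 1) - 1 + F.L ^ (k + 1) + 2)) :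
    ∃ (ℓ₃ : T4Family → NE3Letters₁₁) (B : T4Family → ℝ), N16LettersEnd N g ℓ₃ ∧
      (∀ F : T4Family, 0 < B F ∧ (ℓ₃ F).ε / B F ≤ (ℓ₃ F).b) ∧ (∀ F : T4Family, (C F).B₃ ≤ B F) ∧
      ∀ 𝔯 : RateReading₁₃CoPH N, N16PinnedLoose 𝔯 ℓ₃ B → N16HolderAtReading 𝔯 β := by
  choose ℓ₃ hℓ₃ using fun F => exists_letters_inEndRegimeH_leafSlotHolderAT_of_h5_reg910Slot (N := N) F (hg F) (h5 F) (hGm F) (hG F) (C F) (hR F)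
  have hε0 : ∀ F, 0 < (ℓ₃ F).ε := fun F => (hℓ₃ F).2.2.2.2.2.2.1.2.2.2.1
  have hm : ∀ F, 0 < max (C F).B₃ ((ℓ₃ F).ε / (ℓ₃ F).b) ∧ (C F).B₃ ≤ max (C F).B₃ ((ℓ₃ F).ε / (ℓ₃ F).b) ∧
      (ℓ₃ F).ε / max (C F).B₃ ((ℓ₃ F).ε / (ℓ₃ F).b) ≤ (ℓ₃ F).b := fun F => radiusMatch_max (hε0 F) (hℓ₃ F).2.2.2.1 (C F).B₃_pos
  refine ⟨ℓ₃, fun F => max (C F).B₃ ((ℓ₃ F).ε / (ℓ₃ F).b),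
    fun F => ⟨(hℓ₃ F).1, (hℓ₃ F).2.1, (hℓ₃ F).2.2.1, (hℓ₃ F).2.2.2.1, (hℓ₃ F).2.2.2.2.1, (hℓ₃ F).2.2.2.2.2.1,
      (inEndRegimeH_loose_iff F (ℓ₃ F) _).1 (hℓ₃ F).2.2.2.2.2.2.1⟩, fun F => ⟨(hm F).1, (hm F).2.2⟩, fun F => (hm F).2.1,
    fun 𝔯 hpin => n16HolderAtReading_of_pinnedLoose β hpin fun F => ?_⟩
  exact n16HolderAt_anti_dom F (o := { ne3ConstLayerOfRecord₁₁ F N (ℓ₃ F) with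
      dom := {V | V ∈ ne3DomOfRecord₁₁ F N 0 0 ∧ V ∈ sfClass 4 F.L (ne3NperOfRecord₁₁ F 0 0) ((ℓ₃ F).ε / (C F).B₃) 0} })
    (looseDom_anti F (hε0 F).le (C F).B₃_pos (hm F).2.1) (n16HolderAt_of_inEndRegimeH_leafSlotHolderAT (hℓ₃ F).2.2.2.2.2.2.1 hβ0 hβ1 (hℓ₃ F).2.2.2.2.2.2.2)

/-- **★ THE SAME WITH NODE N19's TWO FURTHER RADIUS GUARDS** (`ε∕B ≤ 1∕4`, `4·(ε∕B) ≤ c'`, `gradConst 4 c' = g F`) at the slot key — module 45's `…_match_n19rows` re-keyed;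
`B F := max (max B₃ (ε∕b)) (max (4ε) (4ε∕c'))`; typed ahead for (t-N16b). [cite: Balaban1985Variational, Thm 1 (9)–(10) p.279] [folklore] -/
theorem exists_letters_n16HolderAtReading_loose_of_h5_reg910Slot_match_n19rows {g : T4Family → ℝ} (hg : ∀ F, 0 < g F)
    (h5 : ∀ F : T4Family, letI : CStarAlgebra (Matrix (Fin N) (Fin N) ℂ) := {}
      ∃ (len : Site 4 → ℝ) (c₁ c₁' B₁' cP C₂ B₀β : ℝ) (inp : B8.B9Inputs),
        (∀ v : Site 4, 0 < len v → 1 ≤ len v) ∧ (∀ μ : Fin 4, len (e μ) = 1) ∧ 0 < B₁' ∧ 5 * ((4 : ℕ) : ℝ) * F.L * inp.B₀ ≤ B₁' ∧ 0 < c₁' ∧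
        (∀ α₀ α₁ : ℝ, 0 < α₀ → 0 < α₁ → α₀ + α₁ ≤ c₁' →
          α₀ + α₁ ≤ c₁ ∧ C0 4 * (2 * α₀) ≤ 1 / 3 ∧ 4 * α₀ ≤ c2' 4 F.L ∧ 16 * (B₁' * (α₀ + α₁)) ≤ 1 ∧
          Real.exp (4 * (800 * (((4 : ℕ) : ℝ) + 1) ^ 2 * (((4 : ℕ) : ℝ) + 4)) * α₀) * (1 + 8 * (131072 * (((4 : ℕ) : ℝ) + 1) ^ 2) * (B₁' * (α₀ + α₁))) ≤ 2 ∧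
          2 * (B₁' * (α₀ + α₁)) ≤ c3 4 F.L ∧ ((4 : ℕ) : ℝ) * F.L * α₁ ≤ 1 / 8 ∧ α₀ ≤ cP ∧ α₁ ≤ cP ∧ B₁' * (α₀ + α₁) ≤ cP ∧
          2 * (B₁' * (α₀ + α₁)) ^ 2 + 20 * ((4 : ℕ) : ℝ) * α₀ * (B₁' * (α₀ + α₁)) + 2 * C₂ * (B₁' * (α₀ + α₁)) ^ 2 ≤ α₀ + α₁) ∧
        B8.Thm4Body c₁ B₁' (fun i : {i : ZdIdx 4 F.L // (∀ j, i.Ω j = Set.univ) ∧ (∀ m j, i.Λs m j = {_y | j = m}) ∧ (∀ m j, i.Λb m j = {_c | j = m}) ∧ i.η = ((F.L : ℝ)⁻¹) ^ i.k} => (zdGF3 (Matrix (Fin N) (Fin N) ℂ) F.L β len i.1).toGFData) ∧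
        B8.Prop3Body cP 4 (F.L : ℝ) C₂ inp B₀β (fun i : {i : ZdIdx 4 F.L // (∀ j, i.Ω j = Set.univ) ∧ (∀ m j, i.Λs m j = {_y | j = m}) ∧ (∀ m j, i.Λb m j = {_c | j = m}) ∧ i.η = ((F.L : ℝ)⁻¹) ^ i.k} => (zdGF3 (Matrix (Fin N) (Fin N) ℂ) F.L β len i.1).toGFData2))
    {G : T4Family → (Site 4 → Fin 4 → (MatA N)ˣ) → Site 4 → ℕ → ℝ → ℝ → ℝ → Prop} (hGm : ∀ F, RadiiMono 4 (G F))
    (hG : ∀ (F : T4Family) (U : Site 4 → Fin 4 → (MatA N)ˣ) (x : Site 4) (K : ℕ) (α₀ α₁ α₂ : ℝ), 2 ≤ K → G F U x K α₀ α₁ α₂ →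
      ∃ (u : Site 4 → (MatA N)ˣ) (a : Site 4 → Fin 4 → MatA N),
        (∀ z, u z ∈ unitaryUnits (MatA N)) ∧
        (∀ (y : Site 4) (τ : Fin 4), l1 (y - x) ≤ 2 → ((gaugeAct u U y τ : (MatA N)ˣ) : MatA N) = exp (a y τ)) ∧
        (∀ (y : Site 4) (τ : Fin 4), l1 (y - x) ≤ 2 → ‖a y τ‖ ≤ α₀) ∧
        (∀ (y : Site 4) (τ i : Fin 4), l1 (y - x) ≤ 1 → ‖fd i (fun z => a z τ) y‖ ≤ α₁) ∧
        (∀ (τ i l : Fin 4), ‖fd i (fd l (fun z => a z τ)) x‖ ≤ α₂))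
    (C : T4Family → B11Thm1.Consts)
    (hR : ∀ (F : T4Family) (k : ℕ) (ε₁ : ℝ), 0 < ε₁ → ε₁ ≤ (C F).a₁ → ∀ (V U : Site 4 → Fin 4 → (MatA N)ˣ), V ∈ sfClass 4 F.L (ne3NperOfRecord₁₁ F 0 0) ε₁ 0 →
      IsMinimiser 4 (sfClass 4 F.L (ne3NperOfRecord₁₁ F 0 0) ((C F).B₃ * ε₁)) F.L (ne3NperOfRecord₁₁ F 0 0) (k + 1) V U →
        ∀ x : Site 4, Regularity (torusVP 4 F.L (ne3NperOfRecord₁₁ F 0 0) (G F) (k + 1)) (C F).B₃ (C F).B₄ ε₁ U (x, F.L ^ (k + 1) - 1 + F.L ^ (k + 1) + 2)) :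
    ∃ (ℓ₃ : T4Family → NE3Letters₁₁) (B : T4Family → ℝ) (c' : T4Family → ℝ), N16LettersEnd N g ℓ₃ ∧
      (∀ F : T4Family, 0 < B F ∧ (ℓ₃ F).ε / B F ≤ (ℓ₃ F).b) ∧ (∀ F : T4Family, (C F).B₃ ≤ B F) ∧
      (∀ F : T4Family, 0 < c' F ∧ gradConst 4 (c' F) = g F ∧ (ℓ₃ F).ε / B F ≤ 1 / 4 ∧ 4 * ((ℓ₃ F).ε / B F) ≤ c' F) ∧
      ∀ 𝔯 : RateReading₁₃CoPH N, N16PinnedLoose 𝔯 ℓ₃ B → N16HolderAtReading 𝔯 β := by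
  choose c' hc' using fun F => exists_gradConst_eq (hg F)
  choose ℓ₃ hℓ₃ using fun F => exists_letters_inEndRegimeH_leafSlotHolderAT_of_h5_reg910Slot (N := N) F (hg F) (h5 F) (hGm F) (hG F) (C F) (hR F)
  have hε0 : ∀ F, 0 < (ℓ₃ F).ε := fun F => (hℓ₃ F).2.2.2.2.2.2.1.2.2.2.1
  have hm := fun F => radiusMatch_max₄ (hε0 F) (hℓ₃ F).2.2.2.1 (C F).B₃_pos (hc' F).1
  refine ⟨ℓ₃, fun F => max (max (C F).B₃ ((ℓ₃ F).ε / (ℓ₃ F).b)) (max (4 * (ℓ₃ F).ε) (4 * (ℓ₃ F).ε / c' F)), c',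
    fun F => ⟨(hℓ₃ F).1, (hℓ₃ F).2.1, (hℓ₃ F).2.2.1, (hℓ₃ F).2.2.2.1, (hℓ₃ F).2.2.2.2.1, (hℓ₃ F).2.2.2.2.2.1,
      (inEndRegimeH_loose_iff F (ℓ₃ F) _).1 (hℓ₃ F).2.2.2.2.2.2.1⟩, fun F => ⟨(hm F).1, (hm F).2.2.1⟩, fun F => (hm F).2.1,
    fun F => ⟨(hc' F).1, (hc' F).2, (hm F).2.2.2.1, (hm F).2.2.2.2⟩, fun 𝔯 hpin => n16HolderAtReading_of_pinnedLoose β hpin fun F => ?_⟩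
  exact n16HolderAt_anti_dom F (o := { ne3ConstLayerOfRecord₁₁ F N (ℓ₃ F) with
      dom := {V | V ∈ ne3DomOfRecord₁₁ F N 0 0 ∧ V ∈ sfClass 4 F.L (ne3NperOfRecord₁₁ F 0 0) ((ℓ₃ F).ε / (C F).B₃) 0} })
    (looseDom_anti F (hε0 F).le (C F).B₃_pos (hm F).2.1) (n16HolderAt_of_inEndRegimeH_leafSlotHolderAT (hℓ₃ F).2.2.2.2.2.2.1 hβ0 hβ1 (hℓ₃ F).2.2.2.2.2.2.2)

end

end Summit.QuantumFields.YangMills.BalabanUVNodes.N16PinnedLooseMatchOfReg910Slot
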